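import Summits.QuantumFields.BalabanUV.Beta.SpineRecursiveW

/-!
# «SLOT-SREC» — the recursive first-order stencil families with TABLE SLOTS: `S0NOf V H`, `SrecOf V H G`, `SpureRecOf V H G`,
# the rooted comb objects `S0NAt ρ` / `SrecAt ρ` / `SpureRecAt ρ` recovered at `(V, H, G) := (vhSAt ρ, hessFFAt ρ, j ↦ coDressKBmAt ρ Lc (KInvStep Lc j))`
# (binder row D1, the row-D1 OWNER's leaf row «HP-SYM-SLOTS», RULING R-D1-g25-2 (3))

HONEST FRAMING (cell charter, verbatim): «discharging BetaPertH makes Balaban's UV stability UNCONDITIONAL — a real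
constructive-QFT result; it is NOT the continuum limit and NOT the Clay problem.»  DERIVED cell leaf (pub-balaban β sub-cell, binder row D1,
cross-cell idle seat `b2b-balaban-t4-ne7b-formalise-leaf-05` gen 22 on the row-D1 OWNER's claimable leaf row «HP-SYM-SLOTS» ∕ «SLOT-SREC»,
RULING R-D1-g25-2 (3), CLAIMS l.24952; INTENT l.25517); no statement of Bałaban's papers is typed here, no `[cite:]` tag, no `Prop` fact; it
instantiates no binder of the β-function wall by itself; it does NOT name, replace or pre-empt any wall literal.  NOT D1, NOT `BetaPertH`;
NOT continuum; NOT Clay.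
HONEST DEPENDENCY (cell records, verbatim): «continuum YM on T⁴ ⇐ BetaPertH ∧ nine spine estimates (0/9 proved); BetaPertH ⇐ (D1) ∧ (D4) ∧
CAP+tail; G-an2-4 gates asym, D1 and NE2/3/4.»

## What is here (a TABLE-SLOT refactor; the landed files stay byte-identical)

leaf-10's recursively-typed step family `WardLocusRecursive.SrecAt ρ cE cVH cΛ` and an2's `SpineRooted.S0NAt ρ` / `SpureRecAt ρ` read the
background through THREE root-dependent ingredients and nothing else: the BORDER table `vhSAt ρ d Lc`, the HESSIAN table `hessFFAt ρ Lc`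
and the DRESSED STEP PROPAGATORS `G_j = coDressKBmAt ρ Lc (KInvStep Lc j)`; the straight resolvents `KInv Lc` / `KInvStep Lc j` (inside
`lamCoeffOf` / `lamCoeffK` / `E2`) and the weights `wE/wVH/wΛ` are root-free and consumed BY NAME.  The re-based literal «JsB12Sym»
(R-D1-g25-1; JSB12SYM-SPINE v1.1 §0 (Σ1)/(Σ2)) swaps exactly these three for their (0.4)-symmetrised twins.  This file makes them
PARAMETERS `V H : Fin (d+1) → (Fin (d+1) → ℤ) → MKer (d+1) (Fib d)`, `G : ℕ → MKer (d+1) (Fib d)` and proves the root-free bookkeeping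
ONCE over the slot, under six DISPLAYED letters (no named `Prop`), each of which the comb instance meets BY NAME (§4):
(LV) `∀ δ ≥ 0, ∃ C, LocStencil V C δ` · (LH) `∀ δ ≥ 0, ∃ C, VertexFamily H Lc C δ` · (DG) `∀ j, ∃ δ C, 0 < δ ∧ 0 ≤ C ∧ Decays (G j) C δ` ·
(TV) `∀ κ u t, V κ (u + Lc•t) = shiftK (−Lc•t) (V κ u)` · (TH) `∀ μ y t, H μ (y + t) = shiftK (−Lc•t) (H μ y)` · (TG) `∀ j t, shiftK (−Lc•t) (G j) = G j`.
* §1 **`S0NOf V H`** (= `S0NAt` with the slots), **`SrecOf V H G`** (= `SrecAt`: member `0` = `S0NOf`, member `j+1` = the cubic sector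
  `e3OfK Lc (G j) (SrecOf … j)` + border `V` + Λ-sector `SLam Lc (lamCoeffK (KInvStep Lc (j+1)) (E2 (j+1)) Lc) H` with the weights verbatim),
  **`SpureRecOf V H G`** (= `SpureRecAt`: `SrecOf` minus its Λ-sector); unfolding lemmas; the Λ-splits `SrecOf_eq_SpureRecOf_add_lam_zero/_succ`
  (`rfl`); **BRIDGES `S0NOf_comb` (`rfl`), `SrecOf_comb`, `SpureRecOf_comb`**: at the comb data the slots ARE `S0NAt ρ` / `SrecAt ρ` / `SpureRecAt ρ`.
* §2 LOCALITY under (LV)(LH)(DG), `Lc ≥ 1`: `locStencil_S0NOf`, **`locStencil_SrecOf`**, `locStencil_SpureRecOf` (every member a local stencil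
  family at some positive rate — the proofs of `locStencil_S0NAt` / `locStencil_SrecAt` / `locStencil_SpureRecAt` with the letters for the an1 lemmas).
* §3 BLOCK-TRANSLATION COVARIANCE under (TV)(TH)(TG): `S0NOf_translate`, **`SrecOf_translate`**, `SpureRecOf_translate`.
* §3b THE DIVERGENCE OF MEMBER `j+1` HAS NO Λ-PART for ANY `H` with (LH): **`divV_SrecOf_succ`** (leaf-10's `divV_SLam_lamCoeffK_E2_eq_zero` BY
  NAME) — the recursion hypothesis `hT` of `WardLocusInduction.hSd_wall_all_S0NAt`, slot-generic.
* §4 THE COMB INSTANCE: `locStencil_SrecAt` / `locStencil_SpureRecAt` / `SrecAt_translate` re-derived through the slot, the six letters being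
  an1's/an2's lemmas BY NAME (consistency; nothing new about the comb).
NOT here: the second-order slots (`T2RecAt`/`WrecAt`/`JsRecWAtOf` — part 2), the `hSd` socket of `WardLocusRecursive` §4 (table-specific),
any JsB12Sym instance or letter, any reflection law.

All declarations `[folklore]` except the three slot definitions `[our object]` (parametrised candidates, asserting nothing); axioms standard.
Provenance: b2b-balaban β sub-cell, cross-cell seat b2b-balaban-t4-ne7b-formalise-leaf-05 gen 22, 2026-08-21 (v1); over `WardLocusRecursive`
(d1-formalise-leaf-10), `SpineRootedS0N`/`SpineRecursiveW`/`ValueJetGeneric` (an2), an1's `AveragingHessianKernelsRooted` BY NAME; no file touched.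
-/

noncomputable section

open Finset
open scoped BigOperators
open Literature.MathematicalPhysics.QuantumFieldTheory
open Literature.MathematicalPhysics.QuantumFieldTheory.Balaban1983to89
open Literature.MathematicalPhysics.QuantumFieldTheory.Balaban1983to89.Beta
open B12Sec2to5 (l1 l1_nonneg)
open ExpKernelCalculus (MKer Decays BiLoc VertexFamily shiftK Zl Zl_nonneg)
open OneStepResolventKernel (Fib KInv LocStencil decays_KInv shiftK_KInv decays_mono)
open OneStepKernelFamily (KInvStep decays_KInvStep shiftK_KInvStep)
open KernelWard (divV)
open AffineAveraging (box toSite)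
open AveragingHessianKernelsRooted (vhSAt locStencil_vhSAt vhSAt_translate hessFFAt biLoc_hessFFAt hessFFAt_translate)
open InterLevelTransport (SLam locStencil_SLam SLam_translate)
open BalabanStepJets (lamCoeffOf abs_lamCoeffOf_le lamCoeffOf_translate locStencil_mono)
open StepJetData (wilsonA wBound locStencil_wilsonA wilsonA_translate locStencil_add locStencil_smul)
open BalabanStepJetsSucc (E2 decays_E2 lamCoeffK abs_lamCoeffK_le lamCoeffK_translate shiftK_E2 wE wVH wΛ)
open Summit.QuantumFields.BalabanUV.Beta.TameKernelCalculus
open Summit.QuantumFields.BalabanUV.Beta.AxialDressingRooted (coDressKBmAt decays_coDressKBmAt_KInvStep shiftK_coDressKBmAt_KInvStep)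
open Summit.QuantumFields.BalabanUV.Beta.SpineRooted (S0NAt e3OfK locStencil_e3OfK e3OfK_translate SpureRecAt SpureRecAt_succ)
open Summit.QuantumFields.BalabanUV.Beta.WardLocusStencils (divV_apply)
open Summit.QuantumFields.BalabanUV.Beta.WardLocusStep (divV_SLam_lamCoeffK_E2_eq_zero)
open Summit.QuantumFields.BalabanUV.Beta.WardLocusCubic (e3K)
open Summit.QuantumFields.BalabanUV.Beta.WardLocusRecursive (SrecAt SrecAt_succ e3OfK_eq_e3K)

variable {d : ℕ}
/-! ## §1 The slotted families and their bridges to the comb objects -/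

namespace Summit.QuantumFields.BalabanUV.Beta.SpineRooted

section DefZero

variable (d) (Lc : ℕ) [NeZero Lc]

/-- [our object — a slotted CANDIDATE, asserting nothing] **THE `j = 0` NATIVE-PLACEMENT SPINE WITH TABLE SLOTS**:
`S0NOf V H cE cVH cΛ κ u := cE • wilsonA d κ u + cVH • V κ u + cΛ • SLam Lc (lamCoeffOf (KInv Lc) Lc) H κ u` — an2's `S0NAt ρ` with the border
table `vhSAt ρ d Lc ↦ V` and the Hessian table `hessFFAt ρ Lc ↦ H`. -/
def S0NOf (V H : Fin (d + 1) → (Fin (d + 1) → ℤ) → MKer (d + 1) (Fib d)) (cE cVH cΛ : ℝ) :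
    Fin (d + 1) → (Fin (d + 1) → ℤ) → MKer (d + 1) (Fib d) :=
  fun κ' u => cE • wilsonA d κ' u + cVH • V κ' u + cΛ • SLam Lc (lamCoeffOf (KInv (N := Lc) (d := d)) Lc) H κ' u

variable {d Lc}

/-- [folklore] **BRIDGE (`rfl`): at the comb tables `S0NOf` IS `S0NAt ρ`.** -/
@[simp] theorem S0NOf_comb (ρ : Fin (d + 1) → ℤ) (cE cVH cΛ : ℝ) :
    S0NOf d Lc (vhSAt ρ d Lc rfl) (fun μ y => hessFFAt ρ Lc μ y) cE cVH cΛ = S0NAt d Lc ρ cE cVH cΛ := rfl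

end DefZero

end Summit.QuantumFields.BalabanUV.Beta.SpineRooted

namespace Summit.QuantumFields.BalabanUV.Beta.WardLocusRecursive

open Summit.QuantumFields.BalabanUV.Beta.SpineRooted (S0NOf S0NOf_comb)

section DefRec

variable (d) (Lc : ℕ) [NeZero Lc]

/-- [our object — a slotted CANDIDATE, asserting nothing] **THE RECURSIVELY-TYPED STEP STENCIL FAMILY WITH TABLE SLOTS** `SrecOf V H G cE cVH cΛ`:
leaf-10's `SrecAt ρ cE cVH cΛ` with `vhSAt ρ ↦ V`, `hessFFAt ρ ↦ H` and the dressed step propagators `coDressKBmAt ρ Lc (KInvStep Lc j) ↦ G j`: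
member `0` = `S0NOf V H`; member `j+1` = `(cE·wE (j+1)) • e3OfK Lc (G j) (SrecOf … j) + (cVH·wVH (j+1)) • V +
(cΛ·wΛ (j+1)) • SLam Lc (lamCoeffK (KInvStep Lc (j+1)) (E2 d Lc (j+1)) Lc) H` (straight resolvents and weights BY NAME). -/
def SrecOf (V H : Fin (d + 1) → (Fin (d + 1) → ℤ) → MKer (d + 1) (Fib d)) (G : ℕ → MKer (d + 1) (Fib d)) (cE cVH cΛ : ℝ) :
    ℕ → Fin (d + 1) → (Fin (d + 1) → ℤ) → MKer (d + 1) (Fib d)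
  | 0 => S0NOf d Lc V H cE cVH cΛ
  | j + 1 => fun κ' u' =>
      (cE * wE d Lc (j + 1)) • e3OfK Lc (G j) (SrecOf V H G cE cVH cΛ j) κ' u' +
        (cVH * wVH d Lc (j + 1)) • V κ' u' +
        (cΛ * wΛ d Lc (j + 1)) • SLam Lc (lamCoeffK (KInvStep (d := d) Lc (j + 1)) (E2 d Lc (j + 1)) Lc) H κ' u'

variable {d Lc}
variable (V H : Fin (d + 1) → (Fin (d + 1) → ℤ) → MKer (d + 1) (Fib d)) (G : ℕ → MKer (d + 1) (Fib d)) (cE cVH cΛ : ℝ)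

/-- [folklore] Member `0` is the slotted native spine. -/
@[simp] theorem SrecOf_zero : SrecOf d Lc V H G cE cVH cΛ 0 = S0NOf d Lc V H cE cVH cΛ := rfl

/-- [folklore] The recursion step (unfolding lemma). -/
theorem SrecOf_succ (j : ℕ) :
    SrecOf d Lc V H G cE cVH cΛ (j + 1) = fun κ' u' =>
      (cE * wE d Lc (j + 1)) • e3OfK Lc (G j) (SrecOf d Lc V H G cE cVH cΛ j) κ' u' +
        (cVH * wVH d Lc (j + 1)) • V κ' u' +
        (cΛ * wΛ d Lc (j + 1)) • SLam Lc (lamCoeffK (KInvStep (d := d) Lc (j + 1)) (E2 d Lc (j + 1)) Lc) H κ' u' := rfl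

/-- [folklore] **BRIDGE: at the comb data `(vhSAt ρ, hessFFAt ρ, j ↦ coDressKBmAt ρ Lc (KInvStep Lc j))` the slotted family IS leaf-10's
`SrecAt ρ`** (induction on the level; member `0` by `rfl`). -/
@[simp] theorem SrecOf_comb (ρ : Fin (d + 1) → ℤ) (cE cVH cΛ : ℝ) :
    ∀ j : ℕ, SrecOf d Lc (vhSAt ρ d Lc rfl) (fun μ y => hessFFAt ρ Lc μ y) (fun j => coDressKBmAt ρ Lc (KInvStep (d := d) Lc j))
      cE cVH cΛ j = SrecAt d Lc ρ cE cVH cΛ j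
  | 0 => rfl
  | j + 1 => by rw [SrecOf_succ, SrecAt_succ, SrecOf_comb ρ cE cVH cΛ j]

end DefRec

end Summit.QuantumFields.BalabanUV.Beta.WardLocusRecursive

namespace Summit.QuantumFields.BalabanUV.Beta.SpineRooted

open Summit.QuantumFields.BalabanUV.Beta.WardLocusRecursive (SrecOf SrecOf_zero SrecOf_succ SrecOf_comb)

section DefPure

variable (d) (Lc : ℕ) [NeZero Lc]

/-- [our object — a slotted CANDIDATE, asserting nothing] **THE UNFOLDED FIRST-ORDER FIELD TABLES WITH TABLE SLOTS** `SpureRecOf V H G cE cVH cΛ`: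
an2's `SpureRecAt ρ` with the slots — member `0` = `cE • wilsonA + cVH • V`, member `j+1` = `(cE·wE (j+1)) • e3OfK Lc (G j) (SrecOf … j) +
(cVH·wVH (j+1)) • V` (the cubic sector reads the FOLDED `SrecOf j`, exactly as `SpureRecAt` reads `SrecAt`). -/
def SpureRecOf (V H : Fin (d + 1) → (Fin (d + 1) → ℤ) → MKer (d + 1) (Fib d)) (G : ℕ → MKer (d + 1) (Fib d)) (cE cVH cΛ : ℝ) :
    ℕ → Fin (d + 1) → (Fin (d + 1) → ℤ) → MKer (d + 1) (Fib d)
  | 0 => fun κ' u' => cE • wilsonA d κ' u' + cVH • V κ' u'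
  | j + 1 => fun κ' u' =>
      (cE * wE d Lc (j + 1)) • e3OfK Lc (G j) (SrecOf d Lc V H G cE cVH cΛ j) κ' u' + (cVH * wVH d Lc (j + 1)) • V κ' u'

variable {d Lc}
variable (V H : Fin (d + 1) → (Fin (d + 1) → ℤ) → MKer (d + 1) (Fib d)) (G : ℕ → MKer (d + 1) (Fib d)) (cE cVH cΛ : ℝ)

/-- [folklore] Member `0`. -/
@[simp] theorem SpureRecOf_zero_level : SpureRecOf d Lc V H G cE cVH cΛ 0 = fun κ' u' => cE • wilsonA d κ' u' + cVH • V κ' u' := rfl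

/-- [folklore] Member `j+1`. -/
@[simp] theorem SpureRecOf_succ (j : ℕ) :
    SpureRecOf d Lc V H G cE cVH cΛ (j + 1) = fun κ' u' =>
      (cE * wE d Lc (j + 1)) • e3OfK Lc (G j) (SrecOf d Lc V H G cE cVH cΛ j) κ' u' + (cVH * wVH d Lc (j + 1)) • V κ' u' := rfl

/-- [folklore] **THE Λ-SPLIT AT LEVEL `0`**: `SrecOf 0 = SpureRecOf 0 + cΛ • SLam Lc (lamCoeffOf (KInv Lc) Lc) H` (`rfl`). -/
theorem SrecOf_eq_SpureRecOf_add_lam_zero (κ' : Fin (d + 1)) (u' : Fin (d + 1) → ℤ) :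
    SrecOf d Lc V H G cE cVH cΛ 0 κ' u' = SpureRecOf d Lc V H G cE cVH cΛ 0 κ' u' +
      cΛ • SLam Lc (lamCoeffOf (KInv (N := Lc) (d := d)) Lc) H κ' u' := rfl

/-- [folklore] **THE Λ-SPLIT AT LEVEL `j+1`**: `SrecOf (j+1) = SpureRecOf (j+1) + (cΛ·wΛ (j+1)) • SLam Lc (lamCoeffK (KInvStep Lc (j+1)) (E2 (j+1)) Lc) H`. -/
theorem SrecOf_eq_SpureRecOf_add_lam_succ (j : ℕ) (κ' : Fin (d + 1)) (u' : Fin (d + 1) → ℤ) :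
    SrecOf d Lc V H G cE cVH cΛ (j + 1) κ' u' = SpureRecOf d Lc V H G cE cVH cΛ (j + 1) κ' u' +
      (cΛ * wΛ d Lc (j + 1)) • SLam Lc (lamCoeffK (KInvStep (d := d) Lc (j + 1)) (E2 d Lc (j + 1)) Lc) H κ' u' := rfl

/-- [folklore] **BRIDGE: at the comb data the slotted unfolded tables ARE an2's `SpureRecAt ρ`** (every level; the cubic sector through
`SrecOf_comb`). -/
@[simp] theorem SpureRecOf_comb (ρ : Fin (d + 1) → ℤ) (cE cVH cΛ : ℝ) :
    ∀ j : ℕ, SpureRecOf d Lc (vhSAt ρ d Lc rfl) (fun μ y => hessFFAt ρ Lc μ y) (fun j => coDressKBmAt ρ Lc (KInvStep (d := d) Lc j))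
      cE cVH cΛ j = SpureRecAt d Lc ρ cE cVH cΛ j
  | 0 => rfl
  | j + 1 => by rw [SpureRecOf_succ, SpureRecAt_succ, SrecOf_comb ρ cE cVH cΛ j]

end DefPure

/-! ## §2 Locality of every member, under (LV)(LH)(DG) -/

section Local

variable {Lc : ℕ} [NeZero Lc]
variable {V H : Fin (d + 1) → (Fin (d + 1) → ℤ) → MKer (d + 1) (Fib d)} {G : ℕ → MKer (d + 1) (Fib d)}

/-- [folklore] **`S0NOf V H` IS A LOCAL STENCIL FAMILY** under (LV)(LH) (the proof of `locStencil_S0NAt` with `locStencil_vhSAt ↦ (LV)`,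
`biLoc_hessFFAt ↦ (LH)`; rate = half the decay rate of `KInv Lc`). -/
theorem locStencil_S0NOf (hV : ∀ δ : ℝ, 0 ≤ δ → ∃ C : ℝ, LocStencil V C δ) (hH : ∀ δ : ℝ, 0 ≤ δ → ∃ C : ℝ, VertexFamily H Lc C δ)
    (cE cVH cΛ : ℝ) : ∃ Cs δ : ℝ, 0 < δ ∧ LocStencil (S0NOf d Lc V H cE cVH cΛ) Cs δ := by
  obtain ⟨δ₀, C, hδ₀, hC, hdec⟩ := decays_KInv (N := Lc) (d := d)
  have hδ2 : (0 : ℝ) ≤ δ₀ / 2 := by positivity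
  have h1 : LocStencil (wilsonA d) (wBound d * Real.exp (4 * (δ₀ / 2))) (δ₀ / 2) := locStencil_wilsonA hδ2
  obtain ⟨C₂, h2⟩ := hV (δ₀ / 2) hδ2
  have hc := abs_lamCoeffOf_le (N := Lc) hdec hC hδ₀.le
  obtain ⟨Cq, hQ⟩ := hH δ₀ hδ₀.le
  have h3 := locStencil_SLam (N := Lc) hc hQ hδ₀ (mul_nonneg (mul_nonneg (by positivity) hC) (Real.exp_pos _).le)
  exact ⟨_, δ₀ / 2, by positivity,
    locStencil_add (locStencil_add (locStencil_smul cE h1) (locStencil_smul cVH h2)) (locStencil_smul cΛ h3)⟩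

/-- [folklore] **EVERY MEMBER OF `SrecOf V H G` IS A LOCAL STENCIL FAMILY** under (LV)(LH)(DG), `Lc ≥ 1` (rate existential per level): member
`0` by `locStencil_S0NOf`, member `j+1` by an2's `locStencil_e3OfK` (decay of `G j` = (DG)) + the border (LV) + the Λ-part ((LH) with
`abs_lamCoeffK_le`) — the proof of `locStencil_SrecAt` verbatim with the letters for the an1 lemmas. -/
theorem locStencil_SrecOf (hLc : 1 ≤ Lc) (hV : ∀ δ : ℝ, 0 ≤ δ → ∃ C : ℝ, LocStencil V C δ)
    (hH : ∀ δ : ℝ, 0 ≤ δ → ∃ C : ℝ, VertexFamily H Lc C δ) (hG : ∀ j : ℕ, ∃ δ C : ℝ, 0 < δ ∧ 0 ≤ C ∧ Decays (G j) C δ)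
    (cE cVH cΛ : ℝ) : ∀ j : ℕ, ∃ Cs δ : ℝ, 0 < δ ∧ LocStencil (SrecOf d Lc V H G cE cVH cΛ j) Cs δ
  | 0 => by rw [SrecOf_zero]; exact locStencil_S0NOf hV hH cE cVH cΛ
  | j + 1 => by
    obtain ⟨Cs, δs, hδs, hS⟩ := locStencil_SrecOf hLc hV hH hG cE cVH cΛ j
    obtain ⟨C₁, δ₁, hδ₁, h1⟩ := locStencil_e3OfK (N := Lc) hLc (hG j) hS hδs
    obtain ⟨δA, CA, hδA, hCA, hA⟩ := decays_KInvStep (Lc := Lc) (d := d) (j + 1)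
    obtain ⟨δE, CE, hδE, hCE, hE⟩ := decays_E2 (d := d) (Lc := Lc) (j + 1)
    set n : ℝ := min δA δE with hn
    have hn0 : 0 < n := lt_min hδA hδE
    have hA' : Decays (KInvStep (d := d) Lc (j + 1)) CA n := decays_mono hA hCA le_rfl (min_le_left _ _)
    have hE' : Decays (E2 d Lc (j + 1)) CE n := decays_mono hE hCE le_rfl (min_le_right _ _)
    have hc := abs_lamCoeffK_le hA' hE' hn0 Lc
    have hn2 : (0 : ℝ) ≤ n / 2 := by positivity
    obtain ⟨Cq, hQ⟩ := hH (n / 2) hn2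
    have h3 := locStencil_SLam (N := Lc) hc hQ (by positivity)
      (mul_nonneg (mul_nonneg (Nat.cast_nonneg _) (mul_nonneg hCA hCE)) (Zl_nonneg (by linarith)))
    set r' : ℝ := min δ₁ (n / 2 / 2) with hr'
    have hr0 : 0 < r' := lt_min hδ₁ (by positivity)
    have hC₁ : 0 ≤ C₁ := (h1 0 0).nonneg (Sum.inl 0)
    have h1r : LocStencil (e3OfK Lc (G j) (SrecOf d Lc V H G cE cVH cΛ j)) C₁ r' := locStencil_mono h1 hC₁ (min_le_left _ _)
    obtain ⟨C₂, h2r⟩ := hV r' hr0.le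
    have h3r := locStencil_mono h3 ((h3 0 0).nonneg (Sum.inl 0)) (min_le_right δ₁ (n / 2 / 2))
    exact ⟨_, r', hr0, fun κ' u' => by
      rw [SrecOf_succ]
      exact (locStencil_add (locStencil_add (locStencil_smul (cE * wE d Lc (j + 1)) h1r)
        (locStencil_smul (cVH * wVH d Lc (j + 1)) h2r)) (locStencil_smul (cΛ * wΛ d Lc (j + 1)) h3r)) κ' u'⟩

/-- [folklore] **EVERY MEMBER OF `SpureRecOf V H G` IS A LOCAL STENCIL FAMILY** under (LV)(LH)(DG), `Lc ≥ 1`: level `0` from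
`locStencil_wilsonA` + (LV); level `j+1` from `locStencil_e3OfK` over `locStencil_SrecOf j`, plus the border. -/
theorem locStencil_SpureRecOf (hLc : 1 ≤ Lc) (hV : ∀ δ : ℝ, 0 ≤ δ → ∃ C : ℝ, LocStencil V C δ)
    (hH : ∀ δ : ℝ, 0 ≤ δ → ∃ C : ℝ, VertexFamily H Lc C δ) (hG : ∀ j : ℕ, ∃ δ C : ℝ, 0 < δ ∧ 0 ≤ C ∧ Decays (G j) C δ)
    (cE cVH cΛ : ℝ) : ∀ j : ℕ, ∃ Cs δ : ℝ, 0 < δ ∧ LocStencil (SpureRecOf d Lc V H G cE cVH cΛ j) Cs δ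
  | 0 => by
    have h1 : LocStencil (wilsonA d) (wBound d * Real.exp (4 * 1)) 1 := locStencil_wilsonA zero_le_one
    obtain ⟨C₂, h2⟩ := hV 1 zero_le_one
    exact ⟨_, 1, one_pos, fun κ' u' => by
      rw [SpureRecOf_zero_level]
      exact (locStencil_add (locStencil_smul cE h1) (locStencil_smul cVH h2)) κ' u'⟩
  | j + 1 => by
    obtain ⟨Cs, δs, hδs, hS⟩ := locStencil_SrecOf (d := d) (Lc := Lc) hLc hV hH hG cE cVH cΛ j
    obtain ⟨C₁, δ₁, hδ₁, h1⟩ := locStencil_e3OfK (N := Lc) hLc (hG j) hS hδs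
    have hC₁ : 0 ≤ C₁ := (h1 0 0).nonneg (Sum.inl 0)
    set r' : ℝ := min δ₁ 1 with hr'
    have hr0 : 0 < r' := lt_min hδ₁ one_pos
    have h1r : LocStencil (e3OfK Lc (G j) (SrecOf d Lc V H G cE cVH cΛ j)) C₁ r' := locStencil_mono h1 hC₁ (min_le_left _ _)
    obtain ⟨C₂, h2r⟩ := hV r' hr0.le
    exact ⟨_, r', hr0, fun κ' u' => by
      rw [SpureRecOf_succ]
      exact (locStencil_add (locStencil_smul (cE * wE d Lc (j + 1)) h1r) (locStencil_smul (cVH * wVH d Lc (j + 1)) h2r)) κ' u'⟩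

end Local

/-! ## §3 Block-translation covariance of every member, under (TV)(TH)(TG) -/

section Translate

variable {Lc : ℕ} [NeZero Lc]
variable {V H : Fin (d + 1) → (Fin (d + 1) → ℤ) → MKer (d + 1) (Fib d)} {G : ℕ → MKer (d + 1) (Fib d)}

/-- [folklore] **BLOCK-TRANSLATION COVARIANCE OF `S0NOf V H`** under (TV)(TH) (the proof of `S0NAt_translate`; the Λ-coefficient by
`lamCoeffOf_translate` over `shiftK_KInv`). -/
theorem S0NOf_translate (hVt : ∀ (κ : Fin (d + 1)) (u t : Fin (d + 1) → ℤ), V κ (u + (Lc : ℤ) • t) = shiftK (-((Lc : ℤ) • t)) (V κ u))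
    (hHt : ∀ (μ : Fin (d + 1)) (y t : Fin (d + 1) → ℤ), H μ (y + t) = shiftK (-((Lc : ℤ) • t)) (H μ y)) (cE cVH cΛ : ℝ)
    (κ' : Fin (d + 1)) (u t : Fin (d + 1) → ℤ) :
    S0NOf d Lc V H cE cVH cΛ κ' (u + (Lc : ℤ) • t) = shiftK (-((Lc : ℤ) • t)) (S0NOf d Lc V H cE cVH cΛ κ' u) := by
  have h1 := wilsonA_translate (d := d) κ' u ((Lc : ℤ) • t)
  have h2 := hVt κ' u t
  have h3 := SLam_translate (N := Lc) (c := lamCoeffOf (KInv (N := Lc) (d := d)) Lc) (Q2 := H)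
    (fun μ y κ'' u' t' => lamCoeffOf_translate (fun s => shiftK_KInv (N := Lc) (d := d) s) μ y κ'' u' t') hHt κ' u t
  funext x z a b
  simp only [S0NOf, Pi.add_apply, Pi.smul_apply, smul_eq_mul, shiftK]
  rw [h1, h2, h3]
  rfl

/-- [folklore] **BLOCK-TRANSLATION COVARIANCE OF EVERY MEMBER OF `SrecOf V H G`** under (TV)(TH)(TG) (block translations `u ↦ u + Lc•t`):
member `0` by `S0NOf_translate`, member `j+1` by an2's `e3OfK_translate` ((TG) for `G j`) + (TV) + `SLam_translate` ((TH); the coefficient by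
`lamCoeffK_translate` over `shiftK_KInvStep` / `shiftK_E2`) — the proof of `SrecAt_translate`. -/
theorem SrecOf_translate (hVt : ∀ (κ : Fin (d + 1)) (u t : Fin (d + 1) → ℤ), V κ (u + (Lc : ℤ) • t) = shiftK (-((Lc : ℤ) • t)) (V κ u))
    (hHt : ∀ (μ : Fin (d + 1)) (y t : Fin (d + 1) → ℤ), H μ (y + t) = shiftK (-((Lc : ℤ) • t)) (H μ y))
    (hGt : ∀ (j : ℕ) (t : Fin (d + 1) → ℤ), shiftK (-((Lc : ℤ) • t)) (G j) = G j) (cE cVH cΛ : ℝ) :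
    ∀ (j : ℕ) (κ' : Fin (d + 1)) (u t : Fin (d + 1) → ℤ),
      SrecOf d Lc V H G cE cVH cΛ j κ' (u + (Lc : ℤ) • t) = shiftK (-((Lc : ℤ) • t)) (SrecOf d Lc V H G cE cVH cΛ j κ' u)
  | 0, κ', u, t => by rw [SrecOf_zero]; exact S0NOf_translate hVt hHt cE cVH cΛ κ' u t
  | j + 1, κ', u, t => by
    have h1 := e3OfK_translate (N := Lc) (K := G j) (hGt j) (S := SrecOf d Lc V H G cE cVH cΛ j)
      (SrecOf_translate hVt hHt hGt cE cVH cΛ j) κ' u ((Lc : ℤ) • t)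
    have h2 := hVt κ' u t
    have h3 := SLam_translate (N := Lc) (c := lamCoeffK (KInvStep (d := d) Lc (j + 1)) (E2 d Lc (j + 1)) Lc) (Q2 := H)
      (fun μ y κ'' u' t' => lamCoeffK_translate (fun s => shiftK_KInvStep (d := d) (Lc := Lc) (j + 1) s)
        (fun s => shiftK_E2 (d := d) (Lc := Lc) (j + 1) _) μ y κ'' u' t') hHt κ' u t
    funext x z a b
    simp only [SrecOf_succ, Pi.add_apply, Pi.smul_apply, smul_eq_mul, shiftK]
    rw [h1, h2, h3]
    rfl

/-- [folklore] **BLOCK-TRANSLATION COVARIANCE OF EVERY MEMBER OF `SpureRecOf V H G`** under (TV)(TH)(TG) (the proof of `SpureRecAt_translate`). -/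
theorem SpureRecOf_translate
    (hVt : ∀ (κ : Fin (d + 1)) (u t : Fin (d + 1) → ℤ), V κ (u + (Lc : ℤ) • t) = shiftK (-((Lc : ℤ) • t)) (V κ u))
    (hHt : ∀ (μ : Fin (d + 1)) (y t : Fin (d + 1) → ℤ), H μ (y + t) = shiftK (-((Lc : ℤ) • t)) (H μ y))
    (hGt : ∀ (j : ℕ) (t : Fin (d + 1) → ℤ), shiftK (-((Lc : ℤ) • t)) (G j) = G j) (cE cVH cΛ : ℝ) :
    ∀ (j : ℕ) (κ' : Fin (d + 1)) (u t : Fin (d + 1) → ℤ),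
      SpureRecOf d Lc V H G cE cVH cΛ j κ' (u + (Lc : ℤ) • t) = shiftK (-((Lc : ℤ) • t)) (SpureRecOf d Lc V H G cE cVH cΛ j κ' u)
  | 0, κ', u, t => by
    have h1 := wilsonA_translate (d := d) κ' u ((Lc : ℤ) • t)
    have h2 := hVt κ' u t
    funext x z a b
    simp only [SpureRecOf_zero_level, Pi.add_apply, Pi.smul_apply, smul_eq_mul, shiftK]
    rw [h1, h2]
    rfl
  | j + 1, κ', u, t => by
    have h1 := e3OfK_translate (N := Lc) (K := G j) (hGt j) (S := SrecOf d Lc V H G cE cVH cΛ j)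
      (SrecOf_translate hVt hHt hGt cE cVH cΛ j) κ' u ((Lc : ℤ) • t)
    have h2 := hVt κ' u t
    funext x z a b
    simp only [SpureRecOf_succ, Pi.add_apply, Pi.smul_apply, smul_eq_mul, shiftK]
    rw [h1, h2]
    rfl

end Translate

/-! ## §3b The divergence of member `j+1` has exactly a cubic and a border sector, for ANY Hessian table with (LH) -/

section Divergence

variable {Lc : ℕ} [NeZero Lc]
variable {V H : Fin (d + 1) → (Fin (d + 1) → ℤ) → MKer (d + 1) (Fib d)} {G : ℕ → MKer (d + 1) (Fib d)}

/-- [folklore] **THE DIVERGENCE OF MEMBER `j+1` OF `SrecOf` HAS NO Λ-PART** (any `V`, `G`; any `H` with (LH) at SOME positive rate):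
`divV (SrecOf … (j+1)) u = (cE·wE (j+1)) • divV (e3K (G j) Lc (SrecOf … j)) u + (cVH·wVH (j+1)) • divV V u` — leaf-10's
`divV_SLam_lamCoeffK_E2_eq_zero` with `A := KInvStep Lc (j+1)` BY NAME; the recursion hypothesis `hT` of `WardLocusInduction.hSd_wall_all_S0NAt`
with `a (j+1) = cE·wE (j+1)`, `b (j+1) = cVH·wVH (j+1)`, slot-generic. -/
theorem divV_SrecOf_succ (hH : ∃ C δ : ℝ, 0 < δ ∧ VertexFamily H Lc C δ) (cE cVH cΛ : ℝ) (j : ℕ) (u : Fin (d + 1) → ℤ) :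
    divV (SrecOf d Lc V H G cE cVH cΛ (j + 1)) u =
      (cE * wE d Lc (j + 1)) • divV (e3K (G j) Lc (SrecOf d Lc V H G cE cVH cΛ j)) u + (cVH * wVH d Lc (j + 1)) • divV V u := by
  obtain ⟨δA, CA, hδA, hCA, hA⟩ := decays_KInvStep (Lc := Lc) (d := d) (j + 1)
  obtain ⟨Cq, δq, hδq, hQ⟩ := hH
  have hΛ := divV_SLam_lamCoeffK_E2_eq_zero (Lc := Lc) (N := Lc) (j + 1) hA hδA hQ hδq u
  rw [← e3OfK_eq_e3K]
  funext x z a b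
  have hΛ' := congr_fun (congr_fun (congr_fun (congr_fun hΛ x) z) a) b
  simp only [divV_apply, Pi.zero_apply, Finset.sum_sub_distrib] at hΛ'
  simp only [divV_apply, Pi.add_apply, Pi.smul_apply, smul_eq_mul, SrecOf_succ, Finset.sum_add_distrib, Finset.sum_sub_distrib,
    ← Finset.mul_sum]
  linear_combination (cΛ * wΛ d Lc (j + 1)) * hΛ'

end Divergence

/-! ## §4 The comb instance: the six letters BY NAME, and the comb facts re-derived through the slot (consistency check) -/

section Comb

variable {Lc : ℕ} [NeZero Lc] {r : Fin (d + 1) → ℕ}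

/-- [folklore] CONSISTENCY: leaf-10's `locStencil_SrecAt` re-derived through the slot (in-block root) — (LV)(LH)(DG) for the comb are an1's
`locStencil_vhSAt` / `biLoc_hessFFAt` and an2's `decays_coDressKBmAt_KInvStep` BY NAME. -/
theorem locStencil_SrecAt_of_slot (hLc : 1 ≤ Lc) (hr : r ∈ box (d + 1) Lc) (cE cVH cΛ : ℝ) (j : ℕ) :
    ∃ Cs δ : ℝ, 0 < δ ∧ LocStencil (SrecAt d Lc (toSite r) cE cVH cΛ j) Cs δ := by
  rw [← SrecOf_comb]
  exact locStencil_SrecOf hLc (fun _ hδ => ⟨_, locStencil_vhSAt hLc hr hδ⟩) (fun _ hδ => ⟨_, fun μ y => biLoc_hessFFAt hLc μ y hr hδ⟩)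
    (fun j => decays_coDressKBmAt_KInvStep (d := d) hr j) cE cVH cΛ j

/-- [folklore] CONSISTENCY: an2's `locStencil_SpureRecAt` re-derived through the slot (in-block root). -/
theorem locStencil_SpureRecAt_of_slot (hLc : 1 ≤ Lc) (hr : r ∈ box (d + 1) Lc) (cE cVH cΛ : ℝ) (j : ℕ) :
    ∃ Cs δ : ℝ, 0 < δ ∧ LocStencil (SpureRecAt d Lc (toSite r) cE cVH cΛ j) Cs δ := by
  rw [← SpureRecOf_comb]
  exact locStencil_SpureRecOf hLc (fun _ hδ => ⟨_, locStencil_vhSAt hLc hr hδ⟩) (fun _ hδ => ⟨_, fun μ y => biLoc_hessFFAt hLc μ y hr hδ⟩)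
    (fun j => decays_coDressKBmAt_KInvStep (d := d) hr j) cE cVH cΛ j

/-- [folklore] CONSISTENCY: leaf-10's `SrecAt_translate` re-derived through the slot (any root) — (TV)(TH)(TG) for the comb are
`vhSAt_translate` / `hessFFAt_translate` / `shiftK_coDressKBmAt_KInvStep` BY NAME. -/
theorem SrecAt_translate_of_slot (ρ : Fin (d + 1) → ℤ) (hLc : 1 ≤ Lc) (cE cVH cΛ : ℝ) (j : ℕ) (κ' : Fin (d + 1))
    (u t : Fin (d + 1) → ℤ) :
    SrecAt d Lc ρ cE cVH cΛ j κ' (u + (Lc : ℤ) • t) = shiftK (-((Lc : ℤ) • t)) (SrecAt d Lc ρ cE cVH cΛ j κ' u) := by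
  rw [← SrecOf_comb]
  exact SrecOf_translate (fun κ u t => vhSAt_translate (d := d) ρ hLc κ u t) (fun μ y t => hessFFAt_translate ρ μ y t)
    (fun j t => shiftK_coDressKBmAt_KInvStep (d := d) ρ j t) cE cVH cΛ j κ' u t

end Comb

end Summit.QuantumFields.BalabanUV.Beta.SpineRooted

end
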